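import Literature.NumberTheory.Automorphic.ShimuraCurveRibetTakahashi
import Literature.NumberTheory.EllipticCurves.ModularDegreeFormulaProofs
import Mathlib.MeasureTheory.Integral.CurveIntegral.Poincare
import Mathlib.Analysis.Complex.Cardinality
import HarnessLib

/-!
# Frey's identity `‖φ^•du‖² = deg(φ) · covol(Λ)` for Shimura-curve parametrisations: proof of
# `ShimuraParametrizationData.normSq_form_eq_deg_mul_covolume`

This file discharges, sorry-free, the named fact
`Literature.NumberTheory.Automorphic.ShimuraParametrizationData.normSq_form_eq_deg_mul_covolume`
of `Literature/NumberTheory/Automorphic/ShimuraCurveRibetTakahashi.lean`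
(`ShimuraParametrizationData.normSq_form_eq_deg_mul_covolume_holds`): for every Shimura-curve
parametrisation datum `P` of a Weierstrass curve `W/ℚ` by `X₀^D(M) = Γ∖ℍ` (`Γ = X.Gamma`) —
weight-two form `form = φ^•(du)`, lattice `Λ_L = P.L.lattice`, `φ(τ) = uniformize (∫_{τ₀}^τ form)`,
degree `deg` —

`∫_{X.fd} |form(z)|² (Im z)² dμ(z) = deg · covol(Λ_L)`,

`μ = dx dy / y²` Mathlib's measure on `ℍ`, `X.fd` the datum's (a.e.) fundamental domain of `Γ`.

## The argument and this file

This is the change of variables for the branched covering `φ : Γ∖ℍ → ℂ/Λ_L` (Zagier, *Modular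
parametrizations of elliptic curves*, Canad. Math. Bull. 28 (1985), §1, p. 374, for `X₀(N)`:
"`‖f‖² = ∬_{Γ∖ℍ} |f|² du dv = … = deg(φ)/(4π²) · (i/2)∬_E dz ∧ dz̄`"; Pasten, *Shimura curves and
the abc conjecture*, §16 (EqFreyQuaternionic), "by the same argument as the proof of (EqFrey)").
The tree proves the classical twin in
`Literature/NumberTheory/EllipticCurves/ModularDegreeFormulaProofs.lean`
(`ModularParametrizationData.zagier_degree_formula_holds`); this file runs the SAME architecture,
reusing its general lemmas (area formula with multiplicity
`Literature.Analysis.Calculus.lintegral_abs_det_fderiv_eq_lintegral_encard`, lattice tiling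
`lintegral_eq_mul_covolume_of_tsum_eq`, measure transfer `lintegral_domain_eq_lintegral_image`,
`volume_image_coe_eq_zero`), with three differences:

1. *The primitive.* Here `Ψ(τ) = ∫_{τ₀}^τ form dτ` is the straight-segment integral
   (`segmentIntegral`). By the Poincaré lemma on the convex set `{Im z > 0}` (Mathlib
   `Convex.exists_forall_hasDerivWithinAt`) `form` has a holomorphic primitive `g` on `ℍ`, and the
   fundamental theorem of calculus along the segment gives `∫_z^w form = g(w) − g(z)`
   (`segmentIntegral_eq_sub`); hence `Ψ' = form` (`hasDerivAt_segmentIntegral`) and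
   `Ψ(γτ) − Ψ(τ) = ∫_τ^{γτ} form ∈ Λ_L` (`period_mem`).
2. *The domain.* `X.fd` is an arbitrary measurable a.e. fundamental domain
   (`IsHypFundamentalDomain`: every orbit meets `fd`; for a.e. `z ∈ fd` the orbit meets `fd` only
   at `z`). The exceptional points form a `μ`-null set whose `Ψ`-image, translated by `Λ_L`, is
   Lebesgue-null, so for a.e. `w ∈ ℂ` every orbit of the fibre `{Γτ : Ψ(τ) ≡ w}` meets `fd` exactly
   once (`encard_fiber_inter_fd_eq_deg`), and the fibre has `deg` orbits off finitely many points
   of `W(ℂ)` (`deg_spec`).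
3. *`form ≠ 0`* is not a field of the datum but follows from `deg_spec`: were `form = 0`, `φ` would
   be constant and every other point of the uncountable `W(ℂ) = uniformize(ℂ)` would have an empty
   fibre (`coe_form_ne_zero`).

No new definitions are made.

## References

* D. Zagier, *Modular parametrizations of elliptic curves*, Canad. Math. Bull. 28 (1985),
  372–384: §1, p. 374. [ZagierCMB1985]
* H. Pasten, *Shimura curves and the abc conjecture*, J. Number Theory 254 (2024) 214–335 =
  arXiv:1705.09251, §3 p. 13 and §16 p. 49 (EqFreyQuaternionic). [PastenShimura2024]
* L. C. Evans, R. F. Gariepy, *Measure Theory and Fine Properties of Functions*, Thm. 3.8.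
-/

noncomputable section

open scoped MatrixGroups ModularForm Topology ENNReal NNReal
open _root_.MeasureTheory Filter Set Function
open UpperHalfPlane hiding I

namespace Literature.NumberTheory.Automorphic

open Literature.NumberTheory.EllipticCurves.ModularForms
  (det_restrictScalars_toSpanSingleton encard_iUnion_of_pairwise_disjoint
    volume_setOf_exists_sub_mem_eq_zero countable_setOf_cuspForm_eq_zero
    lintegral_eq_mul_covolume_of_tsum_eq lintegral_domain_eq_lintegral_image
    volume_image_coe_eq_zero exists_injOn_and_nhds_le_map)

/-! ### Primitives of weight-two forms on `ℍ` and the segment integral -/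

section Primitive

variable {Γ : Subgroup (GL (Fin 2) ℝ)} (f : CuspForm Γ 2)

/-- A cusp form, extended to `ℂ` by `ofComplex`, is holomorphic on `{Im z > 0}`. [folklore] -/
theorem differentiableOn_cuspForm_comp_ofComplex :
    DifferentiableOn ℂ (⇑f ∘ ofComplex) {z : ℂ | 0 < z.im} :=
  UpperHalfPlane.mdifferentiable_iff.mp (CuspFormClass.holo f)

/-- **A weight-two form has a holomorphic primitive on `ℍ`** (Poincaré lemma on the convex open
set `{Im z > 0}`, Mathlib `Convex.exists_forall_hasDerivWithinAt`). [folklore] -/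
theorem exists_hasDerivAt_primitive :
    ∃ g : ℂ → ℂ, ∀ z : ℂ, 0 < z.im → HasDerivAt g (f (ofComplex z)) z := by
  obtain ⟨g, hg⟩ := (convex_halfSpace_im_gt 0).exists_forall_hasDerivWithinAt
    (differentiableOn_cuspForm_comp_ofComplex f)
  exact ⟨g, fun z hz ↦ (hg z hz).hasDerivAt (isOpen_upperHalfPlaneSet.mem_nhds hz)⟩

/-- A point of the segment `[z, w]`, `z, w ∈ ℍ`, `t ∈ [0, 1]`, lies in `ℍ`. [folklore] -/
theorem im_pos_of_mem_segment (z w : ℍ) {t : ℝ} (ht₀ : 0 ≤ t) (ht₁ : t ≤ 1) :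
    0 < ((z : ℂ) + (t : ℂ) * ((w : ℂ) - (z : ℂ))).im := by
  have h : ((z : ℂ) + (t : ℂ) * ((w : ℂ) - (z : ℂ))).im = (1 - t) * z.im + t * w.im := by
    simp only [Complex.add_im, Complex.im_ofReal_mul, Complex.sub_im, UpperHalfPlane.coe_im]
    ring
  rw [h]
  rcases ht₀.eq_or_lt with rfl | ht
  · simpa using z.im_pos
  · exact add_pos_of_nonneg_of_pos (mul_nonneg (sub_nonneg.mpr ht₁) z.im_pos.le)
      (mul_pos ht w.im_pos)

/-- **Fundamental theorem of calculus along a segment of `ℍ`**: if `g` is a holomorphic primitive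
of `f` on `ℍ`, then `∫_z^w f(τ) dτ = g(w) − g(z)` (`segmentIntegral`; the segment lies in the
convex set `ℍ`). [folklore] -/
theorem segmentIntegral_eq_sub {g : ℂ → ℂ} (hg : ∀ z : ℂ, 0 < z.im → HasDerivAt g (f (ofComplex z)) z)
    (z w : ℍ) : segmentIntegral f z w = g w - g z := by
  have hpath : ∀ t : ℝ, (1 - (t : ℂ)) * (z : ℂ) + (t : ℂ) * (w : ℂ) =
      (z : ℂ) + (t : ℂ) * ((w : ℂ) - (z : ℂ)) := fun t ↦ by ring
  have hderiv : ∀ t ∈ uIcc (0 : ℝ) 1,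
      HasDerivAt (fun s : ℝ ↦ g ((z : ℂ) + (s : ℂ) * ((w : ℂ) - (z : ℂ))))
        (f (ofComplex ((z : ℂ) + (t : ℂ) * ((w : ℂ) - (z : ℂ)))) * ((w : ℂ) - (z : ℂ))) t := by
    intro t ht
    rw [uIcc_of_le zero_le_one] at ht
    have hinner : HasDerivAt (fun u : ℂ ↦ (z : ℂ) + u * ((w : ℂ) - (z : ℂ)))
        ((w : ℂ) - (z : ℂ)) (t : ℂ) := by
      simpa using ((hasDerivAt_id (t : ℂ)).mul_const ((w : ℂ) - (z : ℂ))).const_add (z : ℂ)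
    have houter := hg _ (im_pos_of_mem_segment z w ht.1 ht.2)
    exact (houter.comp (t : ℂ) hinner).comp_ofReal
  have hcont : ContinuousOn
      (fun t : ℝ ↦ f (ofComplex ((z : ℂ) + (t : ℂ) * ((w : ℂ) - (z : ℂ)))) * ((w : ℂ) - (z : ℂ)))
      (uIcc (0 : ℝ) 1) := by
    rw [uIcc_of_le zero_le_one]
    refine ContinuousOn.mul ?_ continuousOn_const
    refine (differentiableOn_cuspForm_comp_ofComplex f).continuousOn.comp
      (by fun_prop : Continuous fun t : ℝ ↦ (z : ℂ) + (t : ℂ) * ((w : ℂ) - (z : ℂ))).continuousOn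
      fun t ht ↦ im_pos_of_mem_segment z w ht.1 ht.2
  have hftc := intervalIntegral.integral_eq_sub_of_hasDerivAt hderiv hcont.intervalIntegrable
  simp only [Complex.ofReal_one, one_mul, add_sub_cancel, Complex.ofReal_zero, zero_mul,
    add_zero] at hftc
  rw [← hftc]
  unfold segmentIntegral
  exact intervalIntegral.integral_congr fun t _ ↦ by simp only [hpath]

/-- **`Ψ = ∫_{z₀}^τ f` is holomorphic on `ℍ` with `Ψ' = f`** (as a function on `{Im > 0} ⊆ ℂ`
through `ofComplex`). [folklore] -/
theorem hasDerivAt_segmentIntegral (z₀ : ℍ) {u : ℂ} (hu : 0 < u.im) :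
    HasDerivAt (segmentIntegral f z₀ ∘ ofComplex) (f (ofComplex u)) u := by
  obtain ⟨g, hg⟩ := exists_hasDerivAt_primitive f
  have heq : (fun v : ℂ ↦ g v - g z₀) =ᶠ[𝓝 u] (segmentIntegral f z₀ ∘ ofComplex) := by
    filter_upwards [isOpen_upperHalfPlaneSet.mem_nhds hu] with v hv
    rw [Function.comp_apply, segmentIntegral_eq_sub f hg, ofComplex_apply_of_im_pos hv,
      UpperHalfPlane.coe_mk]
  exact ((hg u hu).sub_const (g z₀)).congr_of_eventuallyEq heq.symm

/-- **Additivity of the segment integral**: `∫_{z₀}^w f − ∫_{z₀}^z f = ∫_z^w f` on `ℍ` (both sides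
are `g(w) − g(z)` for a primitive `g`; Cauchy's theorem for the triangle). [folklore] -/
theorem segmentIntegral_sub_segmentIntegral (z₀ z w : ℍ) :
    segmentIntegral f z₀ w - segmentIntegral f z₀ z = segmentIntegral f z w := by
  obtain ⟨g, hg⟩ := exists_hasDerivAt_primitive f
  simp only [segmentIntegral_eq_sub f hg]
  ring

/-- `Ψ ∘ ofComplex` is complex-differentiable on `{Im > 0}`. [folklore] -/
theorem differentiableOn_segmentIntegral (z₀ : ℍ) :
    DifferentiableOn ℂ (segmentIntegral f z₀ ∘ ofComplex) {z : ℂ | 0 < z.im} :=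
  fun _ hu ↦ (hasDerivAt_segmentIntegral f z₀ hu).differentiableAt.differentiableWithinAt

end Primitive

/-! ### The orbit space `Γ∖ℍ` -/

section Orbits

/-- Two points of `ℍ` have the same image in `Γ∖ℍ` iff they are `Γ`-translates. [folklore] -/
theorem orbitRel_mk_eq_mk_iff {Γ : Subgroup (GL (Fin 2) ℝ)} (τ τ' : ℍ) :
    (Quotient.mk _ τ : MulAction.orbitRel.Quotient Γ ℍ) = Quotient.mk _ τ' ↔
      ∃ γ ∈ Γ, γ • τ' = τ := by
  rw [Quotient.eq, MulAction.orbitRel_apply, MulAction.mem_orbit_iff]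
  constructor
  · rintro ⟨γ, h⟩
    exact ⟨γ, γ.2, h⟩
  · rintro ⟨γ, hγ, h⟩
    exact ⟨⟨γ, hγ⟩, h⟩

end Orbits

namespace ShimuraParametrizationData

/-! ### The datum: periods of `Ψ = ∫_{τ₀}^τ form`, and `form ≠ 0` -/

section Datum

variable {D M : ℕ} {X : ShimuraCurveData D M} {W : WeierstrassCurve ℚ}
  (P : ShimuraParametrizationData X W)

/-- **`Ψ(γτ) − Ψ(τ) ∈ Λ_L` for `γ ∈ Γ`**: `Ψ(γτ) − Ψ(τ) = ∫_τ^{γτ} form` (additivity of the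
segment integral) is a period of `form` (`period_mem`). [folklore] -/
theorem segmentIntegral_smul_sub_mem {γ : GL (Fin 2) ℝ} (hγ : γ ∈ X.Gamma) (τ : ℍ) :
    segmentIntegral P.form P.basePoint (γ • τ) - segmentIntegral P.form P.basePoint τ ∈
      P.L.lattice := by
  rw [segmentIntegral_sub_segmentIntegral]
  exact P.period_mem γ hγ τ

/-- The preimage under `uniformize` of a finite subset of `W(ℂ)` is countable (finitely many
cosets of the countable lattice `Λ_L = ker uniformize`). [folklore] -/
theorem countable_preimage_uniformize {E : Set (W.baseChange ℂ).toAffine.Point} (hE : E.Finite) :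
    (P.uniformize ⁻¹' E).Countable := by
  classical
  haveI : Countable P.L.lattice := Countable.of_equiv _ P.L.latticeEquivProd.toEquiv.symm
  choose wP hwP using fun Q ↦ P.uniformize_surjective Q
  refine Set.Countable.mono (fun x hx ↦ ?_)
    (hE.countable.biUnion fun Q _ ↦ Set.countable_range (fun l : P.L.lattice ↦ wP Q + (l : ℂ)))
  have hl : x - wP (P.uniformize x) ∈ P.L.lattice := by
    rw [← P.uniformize_eq_zero_iff, map_sub, hwP, sub_self]
  exact mem_iUnion₂.mpr ⟨P.uniformize x, hx, ⟨x - wP _, hl⟩, add_sub_cancel _ _⟩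

/-- **`form ≠ 0`.** Were `form = 0`, `Ψ = ∫ form` would vanish identically, `φ = uniformize ∘ Ψ`
would be the constant `0`, and every point `Q ≠ 0` of `W(ℂ)` would have an empty fibre, i.e.
`0 ≠ deg` orbits over it; by `deg_spec` all but finitely many points have exactly `deg` orbits
over them, so `W(ℂ)` would be finite and `ℂ = uniformize⁻¹(W(ℂ))` countable (finitely many
cosets of `Λ_L`) — absurd. [folklore] -/
theorem coe_form_ne_zero : (⇑P.form : ℍ → ℂ) ≠ 0 := by
  intro h0
  have hΨ : ∀ τ : ℍ, segmentIntegral P.form P.basePoint τ = 0 := fun τ ↦ by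
    simp [segmentIntegral, h0]
  have hsub : (Set.univ : Set (W.baseChange ℂ).toAffine.Point) ⊆
      {Q | Nat.card {y : MulAction.orbitRel.Quotient X.Gamma ℍ // ∃ τ : ℍ,
        (Quotient.mk _ τ : MulAction.orbitRel.Quotient X.Gamma ℍ) = y ∧
          P.uniformize (segmentIntegral P.form P.basePoint τ) = Q} ≠ P.deg} ∪ {0} := by
    intro Q _
    by_cases hQ : Q = 0
    · exact Or.inr hQ
    · refine Or.inl ?_
      simp only [mem_setOf_eq]
      haveI : IsEmpty {y : MulAction.orbitRel.Quotient X.Gamma ℍ // ∃ τ : ℍ,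
          (Quotient.mk _ τ : MulAction.orbitRel.Quotient X.Gamma ℍ) = y ∧
            P.uniformize (segmentIntegral P.form P.basePoint τ) = Q} := by
        refine ⟨fun y ↦ ?_⟩
        obtain ⟨τ, -, hτ⟩ := y.2
        apply hQ
        rw [← hτ, hΨ, map_zero]
      rw [Nat.card_of_isEmpty]
      exact P.deg_pos.ne
  have hfin : (Set.univ : Set (W.baseChange ℂ).toAffine.Point).Finite :=
    (P.deg_spec.union (Set.finite_singleton 0)).subset hsub
  have hcount : (Set.univ : Set ℂ).Countable := by
    have := P.countable_preimage_uniformize hfin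
    rwa [Set.preimage_univ] at this
  exact not_countable_complex hcount

end Datum

/-! ### The area-formula step: `∫_U |form|² dx dy = ∫_ℂ #(Ψ⁻¹(y) ∩ U) dy` -/

section AreaStep

variable {D M : ℕ} {X : ShimuraCurveData D M} {W : WeierstrassCurve ℚ}
  (P : ShimuraParametrizationData X W)

/-- `Ψ ∘ ofComplex` is real-differentiable at every point of (the image in `ℂ` of) a subset of
`ℍ`, with derivative multiplication by `Ψ'(τ) = form(τ)`. [folklore] -/
theorem hasFDerivWithinAt_segmentIntegral (S : Set ℍ) :
    ∀ x ∈ ((↑) : ℍ → ℂ) '' S, HasFDerivWithinAt (segmentIntegral P.form P.basePoint ∘ ofComplex)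
      ((ContinuousLinearMap.toSpanSingleton ℂ (P.form (ofComplex x))).restrictScalars ℝ)
      (((↑) : ℍ → ℂ) '' S) x := by
  rintro _ ⟨τ, -, rfl⟩
  exact ((hasDerivAt_segmentIntegral P.form P.basePoint τ.im_pos).hasFDerivAt.restrictScalars
    ℝ).hasFDerivWithinAt

/-- **Local injectivity of `Ψ` off the zeros of `form`** (inverse function theorem on `ℍ`,
`exists_injOn_and_nhds_le_map`; `Ψ' = form`). [folklore] -/
theorem exists_injOn_nhdsWithin_segmentIntegral {S : Set ℍ} (hS : ∀ τ ∈ S, P.form τ ≠ 0) :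
    ∀ x ∈ ((↑) : ℍ → ℂ) '' S, ∃ V ∈ 𝓝[((↑) : ℍ → ℂ) '' S] x,
      InjOn (segmentIntegral P.form P.basePoint ∘ ofComplex) V := by
  rintro _ ⟨τ, hτ, rfl⟩
  have hne : P.form (ofComplex (τ : ℂ)) ≠ 0 := by
    rw [ofComplex_apply]
    exact hS τ hτ
  obtain ⟨⟨V, hV, hVinj⟩, -⟩ := exists_injOn_and_nhds_le_map
    (differentiableOn_segmentIntegral P.form P.basePoint)
    (hasDerivAt_segmentIntegral P.form P.basePoint τ.im_pos) hne
  refine ⟨((↑) : ℍ → ℂ) '' V,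
    mem_nhdsWithin_of_mem_nhds (isOpenEmbedding_coe.image_mem_nhds.mpr hV), ?_⟩
  rintro _ ⟨σ, hσ, rfl⟩ _ ⟨σ', hσ', rfl⟩ h
  simp only [Function.comp_apply, ofComplex_apply] at h
  rw [hVinj hσ hσ' h]

/-- The image in `ℂ` of `U = fd ∩ {form ≠ 0}` is measurable. [folklore] -/
theorem measurableSet_image_fd_inter :
    MeasurableSet (((↑) : ℍ → ℂ) '' (X.fd ∩ {τ | P.form τ ≠ 0})) :=
  measurableEmbedding_coe.measurableSet_image.mpr
    (X.isHypFundamentalDomain_fd.measurableSet.inter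
      (isOpen_ne_fun (ModularFormClass.continuous P.form) continuous_const).measurableSet)

/-- The multiplicity function `y ↦ #{z ∈ U : Ψ(z) = y}` is measurable
(`Literature.Analysis.Calculus.measurable_encard_preimage_inter`). [folklore] -/
theorem measurable_encard_fiber :
    Measurable fun y : ℂ ↦ (((segmentIntegral P.form P.basePoint ∘ ofComplex) ⁻¹' {y} ∩
      ((↑) : ℍ → ℂ) '' (X.fd ∩ {τ | P.form τ ≠ 0})).encard : ℝ≥0∞) :=
  _root_.Literature.Analysis.Calculus.measurable_encard_preimage_inter
    (measurableSet_image_fd_inter P) (hasFDerivWithinAt_segmentIntegral P _)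
    (exists_injOn_nhdsWithin_segmentIntegral P fun _ h ↦ h.2)

/-- **The area formula applied to `Ψ` on `U = fd ∩ {form ≠ 0}`**
(`Literature.Analysis.Calculus.lintegral_abs_det_fderiv_eq_lintegral_encard`, Evans–Gariepy
Thm. 3.8 in the locally injective case; the real Jacobian of `Ψ` is `|Ψ'|² = |form|²`):
`∫_U |form|² dx dy = ∫_ℂ #{z ∈ U : Ψ(z) = y} dy` — the step "`‖f‖² = ∬ φ^*(dx dy)` counted with
multiplicity" of Zagier 1985, §1. [folklore] -/
theorem lintegral_fd_eq_lintegral_encard :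
    ∫⁻ z in ((↑) : ℍ → ℂ) '' (X.fd ∩ {τ | P.form τ ≠ 0}),
        ENNReal.ofReal (‖P.form (ofComplex z)‖ ^ 2) =
      ∫⁻ y, (((segmentIntegral P.form P.basePoint ∘ ofComplex) ⁻¹' {y} ∩
        ((↑) : ℍ → ℂ) '' (X.fd ∩ {τ | P.form τ ≠ 0})).encard : ℝ≥0∞) := by
  rw [← _root_.Literature.Analysis.Calculus.lintegral_abs_det_fderiv_eq_lintegral_encard
    volume (measurableSet_image_fd_inter P) (hasFDerivWithinAt_segmentIntegral P _)
    (exists_injOn_nhdsWithin_segmentIntegral P fun _ h ↦ h.2)]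
  refine setLIntegral_congr_fun (measurableSet_image_fd_inter P) ?_
  rintro _ ⟨τ, -, rfl⟩
  dsimp only
  rw [det_restrictScalars_toSpanSingleton, abs_of_nonneg (sq_nonneg _)]

end AreaStep

/-! ### Counting: the fibres of `Γ∖ℍ → ℂ/Λ_L` through the domain -/

section Counting

variable {D M : ℕ} {X : ShimuraCurveData D M} {W : WeierstrassCurve ℚ}
  (P : ShimuraParametrizationData X W)

/-- **The degree, read in `ℂ`**: off the (finitely many) exceptional points of `deg_spec`, the
fibre of `Γ∖ℍ → ℂ/Λ_L ≅ W(ℂ)` over `uniformize w` consists of exactly `deg` orbits, i.e.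
`#{Γτ : Ψ(τ) ≡ w (mod Λ_L)} = deg` (`ker uniformize = Λ_L`). [folklore] -/
theorem natCard_fiber_eq_deg {w : ℂ}
    (hw : P.uniformize w ∉ {Q | Nat.card {y : MulAction.orbitRel.Quotient X.Gamma ℍ // ∃ τ : ℍ,
      (Quotient.mk _ τ : MulAction.orbitRel.Quotient X.Gamma ℍ) = y ∧
        P.uniformize (segmentIntegral P.form P.basePoint τ) = Q} ≠ P.deg}) :
    Nat.card {y : MulAction.orbitRel.Quotient X.Gamma ℍ // ∃ τ : ℍ,
      (Quotient.mk _ τ : MulAction.orbitRel.Quotient X.Gamma ℍ) = y ∧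
        segmentIntegral P.form P.basePoint τ - w ∈ P.L.lattice} = P.deg := by
  simp only [mem_setOf_eq, not_not] at hw
  rw [← hw]
  refine Nat.card_congr (Equiv.subtypeEquivRight fun y ↦ ?_)
  refine exists_congr fun τ ↦ and_congr_right fun _ ↦ ?_
  rw [← P.uniformize_eq_zero_iff, map_sub, sub_eq_zero]

/-- **Orbits versus points of the domain.** If the fibre `{Γτ : Ψ(τ) ≡ w}` has `deg` orbits and
each of its points lying in `fd` is the only point of its orbit in `fd`, then the fibre meets `fd`
in exactly `deg` points (every orbit meets `fd`, `IsHypFundamentalDomain.covers`, and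
`Ψ(γτ) ≡ Ψ(τ)`). [folklore] -/
theorem encard_fiber_inter_fd_eq_deg {w : ℂ}
    (hdeg : Nat.card {y : MulAction.orbitRel.Quotient X.Gamma ℍ // ∃ τ : ℍ,
      (Quotient.mk _ τ : MulAction.orbitRel.Quotient X.Gamma ℍ) = y ∧
        segmentIntegral P.form P.basePoint τ - w ∈ P.L.lattice} = P.deg)
    (huniq : ∀ τ ∈ X.fd, segmentIntegral P.form P.basePoint τ - w ∈ P.L.lattice →
      ∀ γ ∈ X.Gamma, γ • τ ∈ X.fd → γ • τ = τ) :
    ({τ : ℍ | τ ∈ X.fd ∧ segmentIntegral P.form P.basePoint τ - w ∈ P.L.lattice}.encard :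
      ℝ≥0∞) = P.deg := by
  set A : Set ℍ := {τ : ℍ | τ ∈ X.fd ∧ segmentIntegral P.form P.basePoint τ - w ∈ P.L.lattice}
    with hA
  set T := {y : MulAction.orbitRel.Quotient X.Gamma ℍ // ∃ τ : ℍ,
      (Quotient.mk _ τ : MulAction.orbitRel.Quotient X.Gamma ℍ) = y ∧
        segmentIntegral P.form P.basePoint τ - w ∈ P.L.lattice} with hT
  let e : ↥A → T := fun τ ↦ ⟨Quotient.mk _ (τ : ℍ), τ, rfl, τ.2.2⟩
  have hinj : Injective e := by
    rintro ⟨τ, hτF, hτΛ⟩ ⟨τ', hτF', hτΛ'⟩ h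
    have h' : (Quotient.mk _ τ : MulAction.orbitRel.Quotient X.Gamma ℍ) = Quotient.mk _ τ' :=
      congrArg Subtype.val h
    obtain ⟨γ, hγ, rfl⟩ := (orbitRel_mk_eq_mk_iff τ τ').mp h'
    exact Subtype.ext (huniq τ' hτF' hτΛ' γ hγ hτF)
  have hsurj : Surjective e := by
    rintro ⟨y, τ₀, hy, hΛ⟩
    obtain ⟨γ, hγ, hγF⟩ := X.isHypFundamentalDomain_fd.covers τ₀
    have hA₁ : γ • τ₀ ∈ A := by
      refine ⟨hγF, ?_⟩
      have := P.L.lattice.add_mem (P.segmentIntegral_smul_sub_mem hγ τ₀) hΛ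
      rwa [sub_add_sub_cancel] at this
    refine ⟨⟨γ • τ₀, hA₁⟩, Subtype.ext ?_⟩
    change (Quotient.mk _ (γ • τ₀) : MulAction.orbitRel.Quotient X.Gamma ℍ) = y
    rw [← hy]
    exact (orbitRel_mk_eq_mk_iff _ _).mpr ⟨γ, hγ, rfl⟩
  have hcard : Nat.card ↥A = P.deg :=
    (Nat.card_congr (Equiv.ofBijective e ⟨hinj, hsurj⟩)).trans hdeg
  have hfin : A.Finite := by
    have : Finite ↥A := Nat.finite_of_card_ne_zero (hcard ▸ P.deg_pos.ne')
    exact Set.toFinite A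
  rw [← hfin.cast_ncard_eq, ENat.toENNReal_coe, ← Nat.card_coe_set_eq, hcard]

/-- **The periodised multiplicity is `deg` almost everywhere.** For a.e. `w ∈ ℂ`, the points `z`
of `U = fd ∩ {form ≠ 0}` with `Ψ(z) ≡ w (mod Λ_L)` number exactly `deg`: off three null sets —
the cosets of `Λ_L` through the finitely many exceptional points of `deg_spec`
(`countable_preimage_uniformize`); the `Λ_L`-translates of `Ψ` of the `μ`-null set of points of
`fd` whose orbit meets `fd` elsewhere (`IsHypFundamentalDomain.ae_unique`; images of null sets
under the differentiable `Ψ` are null, Mathlib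
`addHaar_image_eq_zero_of_differentiableOn_of_addHaar_eq_zero`); and of `Ψ` of the countable
zero set of `form ≠ 0` — the fibre has `deg` orbits (`natCard_fiber_eq_deg`), each meeting `fd`
exactly once (`encard_fiber_inter_fd_eq_deg`), at a non-zero of `form`. [folklore] -/
theorem ae_tsum_encard_fiber_eq_deg :
    ∀ᵐ w : ℂ, ∑' l : P.L.lattice,
      (((segmentIntegral P.form P.basePoint ∘ ofComplex) ⁻¹' {(l : ℂ) + w} ∩
        ((↑) : ℍ → ℂ) '' (X.fd ∩ {τ | P.form τ ≠ 0})).encard : ℝ≥0∞) = P.deg := by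
  classical
  haveI : Countable P.L.lattice := Countable.of_equiv _ P.L.latticeEquivProd.toEquiv.symm
  have hΛc : (P.L.lattice : Set ℂ).Countable := Set.countable_coe_iff.mp inferInstance
  set Ψ : ℍ → ℂ := segmentIntegral P.form P.basePoint with hΨ
  -- the three null sets
  have hbad₁ : volume (P.uniformize ⁻¹' {Q | Nat.card {y : MulAction.orbitRel.Quotient X.Gamma ℍ //
      ∃ τ : ℍ, (Quotient.mk _ τ : MulAction.orbitRel.Quotient X.Gamma ℍ) = y ∧
        P.uniformize (Ψ τ) = Q} ≠ P.deg}) = 0 :=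
    (P.countable_preimage_uniformize P.deg_spec).measure_zero _
  have hΨdiff : DifferentiableOn ℝ (Ψ ∘ ofComplex) {z : ℂ | 0 < z.im} :=
    (differentiableOn_segmentIntegral P.form P.basePoint).restrictScalars ℝ
  have hbad₂ : volume {w : ℂ | ∃ v ∈ Ψ '' {τ : ℍ | ¬ (τ ∈ X.fd → ∀ γ ∈ X.Gamma, γ • τ ∈ X.fd →
      γ • τ = τ)}, v - w ∈ (P.L.lattice : Set ℂ)} = 0 := by
    refine volume_setOf_exists_sub_mem_eq_zero hΛc ?_
    have himg : Ψ '' {τ : ℍ | ¬ (τ ∈ X.fd → ∀ γ ∈ X.Gamma, γ • τ ∈ X.fd → γ • τ = τ)} =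
        (Ψ ∘ ofComplex) '' (((↑) : ℍ → ℂ) ''
          {τ : ℍ | ¬ (τ ∈ X.fd → ∀ γ ∈ X.Gamma, γ • τ ∈ X.fd → γ • τ = τ)}) := by
      rw [image_image]
      exact image_congr fun τ _ ↦ by simp [ofComplex_apply]
    rw [himg]
    refine addHaar_image_eq_zero_of_differentiableOn_of_addHaar_eq_zero volume
      (hΨdiff.mono ?_) (volume_image_coe_eq_zero (ae_iff.mp X.isHypFundamentalDomain_fd.ae_unique))
    rintro _ ⟨τ, -, rfl⟩
    exact τ.im_pos
  have hbad₃ : volume {w : ℂ | ∃ v ∈ Ψ '' {τ : ℍ | P.form τ = 0},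
      v - w ∈ (P.L.lattice : Set ℂ)} = 0 :=
    volume_setOf_exists_sub_mem_eq_zero hΛc
      (((countable_setOf_cuspForm_eq_zero P.form P.coe_form_ne_zero).image _).measure_zero _)
  filter_upwards [measure_eq_zero_iff_ae_notMem.mp hbad₁, measure_eq_zero_iff_ae_notMem.mp hbad₂,
    measure_eq_zero_iff_ae_notMem.mp hbad₃] with w hw₁ hw₂ hw₃
  have hdeg := P.natCard_fiber_eq_deg hw₁
  have huniq : ∀ τ ∈ X.fd, Ψ τ - w ∈ P.L.lattice → ∀ γ ∈ X.Gamma, γ • τ ∈ X.fd → γ • τ = τ := by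
    intro τ hτF hτΛ γ hγ hγF
    by_contra hne
    exact hw₂ ⟨_, ⟨τ, fun h ↦ hne (h hτF γ hγ hγF), rfl⟩, hτΛ⟩
  have hnz : ∀ τ : ℍ, Ψ τ - w ∈ P.L.lattice → P.form τ ≠ 0 := fun τ hτ hf ↦
    hw₃ ⟨_, ⟨τ, hf, rfl⟩, hτ⟩
  rw [← P.encard_fiber_inter_fd_eq_deg hdeg huniq, ← encard_iUnion_of_pairwise_disjoint]
  · have hset : (⋃ l : P.L.lattice, (Ψ ∘ ofComplex) ⁻¹' {(l : ℂ) + w} ∩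
        ((↑) : ℍ → ℂ) '' (X.fd ∩ {τ | P.form τ ≠ 0})) =
        ((↑) : ℍ → ℂ) '' {τ : ℍ | τ ∈ X.fd ∧ Ψ τ - w ∈ P.L.lattice} := by
      ext z
      simp only [mem_iUnion, mem_inter_iff, mem_preimage, mem_singleton_iff, Function.comp_apply]
      constructor
      · rintro ⟨l, hzl, τ, ⟨hτF, -⟩, rfl⟩
        refine ⟨τ, ⟨hτF, ?_⟩, rfl⟩
        rw [ofComplex_apply] at hzl
        rw [hzl, add_sub_cancel_right]
        exact l.2
      · rintro ⟨τ, ⟨hτF, hτΛ⟩, rfl⟩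
        refine ⟨⟨Ψ τ - w, hτΛ⟩, ?_, τ, ⟨hτF, hnz τ hτΛ⟩, rfl⟩
        rw [ofComplex_apply, Submodule.coe_mk, sub_add_cancel]
    rw [hset, coe_injective.encard_image]
  · intro l l' hll'
    simp only [Function.onFun]
    refine Set.disjoint_left.mpr fun z hz hz' ↦ hll' ?_
    have h1 : (Ψ ∘ ofComplex) z = (l : ℂ) + w := hz.1
    have h2 : (Ψ ∘ ofComplex) z = (l' : ℂ) + w := hz'.1
    exact Subtype.ext (add_right_cancel (h1.symm.trans h2))

end Counting

/-! ### Assembly -/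

section Assembly

variable {D M : ℕ} {X : ShimuraCurveData D M} {W : WeierstrassCurve ℚ}
  (P : ShimuraParametrizationData X W)

/-- **Frey's identity in `ℝ≥0∞`**: `∫⁻_{fd} |form|² y² dμ = deg · covol(Λ_L)`. Proof:
(1) `∫⁻_{fd} |form|² y² dμ = ∫⁻_{fd ⊆ ℂ} |form|² dx dy` (`lintegral_domain_eq_lintegral_image`);
(1') the countable zero set of `form` does not contribute; (2) area formula with multiplicity
(`lintegral_fd_eq_lintegral_encard`); (3) tiling `ℂ` by `Λ_L`: the multiplicity periodises to the
number of points of `fd` over `y mod Λ_L`, which is `deg` a.e. (`ae_tsum_encard_fiber_eq_deg`),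
so the integral is `deg · covol(Λ_L)` (`lintegral_eq_mul_covolume_of_tsum_eq`). [folklore] -/
theorem lintegral_fd_normSq_eq :
    ∫⁻ τ in X.fd, ENNReal.ofReal (‖P.form τ‖ ^ 2 * τ.im ^ 2) =
      P.deg * ENNReal.ofReal (ZLattice.covolume P.L.lattice) := by
  classical
  haveI : Countable P.L.lattice := Countable.of_equiv _ P.L.latticeEquivProd.toEquiv.symm
  have hF : MeasurableSet X.fd := X.isHypFundamentalDomain_fd.measurableSet
  have hUm := measurableSet_image_fd_inter P
  -- (1) the hyperbolic integral as a Lebesgue integral over `fd ⊆ ℂ`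
  rw [lintegral_domain_eq_lintegral_image hF P.form]
  -- (1') the zeros of `form` do not contribute
  have hB : ∫⁻ z in ((↑) : ℍ → ℂ) '' X.fd, ENNReal.ofReal (‖P.form (ofComplex z)‖ ^ 2) =
      ∫⁻ z in ((↑) : ℍ → ℂ) '' (X.fd ∩ {τ | P.form τ ≠ 0}),
        ENNReal.ofReal (‖P.form (ofComplex z)‖ ^ 2) := by
    symm
    have hsub : ((↑) : ℍ → ℂ) '' (X.fd ∩ {τ | P.form τ ≠ 0}) ⊆ ((↑) : ℍ → ℂ) '' X.fd :=
      image_mono inter_subset_left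
    rw [← inter_eq_self_of_subset_left hsub, ← Measure.restrict_restrict hUm,
      ← lintegral_indicator hUm]
    refine setLIntegral_congr_fun (measurableEmbedding_coe.measurableSet_image.mpr hF) ?_
    rintro _ ⟨τ, hτ, rfl⟩
    dsimp only
    by_cases hf : P.form τ = 0
    · rw [indicator_of_notMem, ofComplex_apply, hf, norm_zero, zero_pow two_ne_zero,
        ENNReal.ofReal_zero]
      intro hmem
      exact ((coe_injective.mem_set_image).mp hmem).2 hf
    · rw [indicator_of_mem]
      exact ⟨τ, ⟨hτ, hf⟩, rfl⟩
  -- (2) area formula, (3) tiling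
  rw [hB, lintegral_fd_eq_lintegral_encard P]
  exact lintegral_eq_mul_covolume_of_tsum_eq P.L.lattice (measurable_encard_fiber P)
    (ae_tsum_encard_fiber_eq_deg P)

/-- **Frey's identity `‖φ^•du‖² = deg(φ) · covol(Λ_L)`** for one Shimura-curve parametrisation
datum: `∫_{fd} |form|² (Im z)² dμ = deg · covol(Λ_L)` (`lintegral_fd_normSq_eq`, read in `ℝ`; the
Bochner integral `X.normSq` is the `toReal` of the finite `ℝ≥0∞`-integral). [folklore] -/
theorem normSq_form_eq : X.normSq P.form = P.deg * ZLattice.covolume P.L.lattice := by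
  have hmeas : AEStronglyMeasurable (fun τ : ℍ ↦ ‖P.form τ‖ ^ 2 * τ.im ^ 2)
      (volume.restrict X.fd) :=
    (((ModularFormClass.continuous P.form).norm.pow 2).mul
      (continuous_im.pow 2)).aestronglyMeasurable
  have h0 : 0 ≤ᵐ[volume.restrict X.fd] fun τ : ℍ ↦ ‖P.form τ‖ ^ 2 * τ.im ^ 2 :=
    Eventually.of_forall fun τ ↦ (by positivity : (0 : ℝ) ≤ ‖P.form τ‖ ^ 2 * τ.im ^ 2)
  unfold ShimuraCurveData.normSq peterssonNormSq
  rw [integral_eq_lintegral_of_nonneg_ae h0 hmeas, lintegral_fd_normSq_eq, ENNReal.toReal_mul,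
    ENNReal.toReal_natCast, ENNReal.toReal_ofReal (ZLattice.covolume_pos _ _).le]

end Assembly

/-! ### Discharge -/

section Discharge

/-- **Frey's identity `‖φ^•du‖² = deg(φ) · covol(Λ)`** — discharge of the named fact
`ShimuraParametrizationData.normSq_form_eq_deg_mul_covolume` for every Shimura-curve
parametrisation datum: `∫_{X.fd} |P.form|² (Im z)² dμ = P.deg · covol(Λ_L)`, the change of
variables for the degree-`deg` holomorphic map `φ : Γ∖ℍ → ℂ/Λ_L` (`|form|² dx dy = φ^*(dA)`),
as in Zagier 1985 §1 for `X₀(N)` (tree: `ModularParametrizationData.zagier_degree_formula_holds`)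
and Pasten 2024 §16 (EqFreyQuaternionic) for `X₀^D(M)`. See `normSq_form_eq` and
`lintegral_fd_normSq_eq` for the proof. [folklore] -/
theorem normSq_form_eq_deg_mul_covolume_holds : normSq_form_eq_deg_mul_covolume := by
  intro D M X W _ P
  exact normSq_form_eq P

end Discharge

end ShimuraParametrizationData


end Literature.NumberTheory.Automorphic

end
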